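import Summits.Ventures.WeilGRH.FrontierDoubleRungsComplex
import Summits.Ventures.WeilGRH.CensusDoubleReflectionValues
import HarnessLib

/-!
# GRH arm (rh-explicit, venture WeilGRH): the `ζ` frontier `4023/5000` for the named census characters with `χ(2) = ±i`

Cell `rh-explicit`, WEIL TRACK — GRH ARM, seat weil-grh-2 (gen3). Discharge of `FrontierDoubleRungsComplex.lean` for the
census characters `15.2` (`χ(2) = e(3/4) = −i`, `χ(3) = 0`), `15.8` (`χ(2) = i`), `17.8` (`χ(2) = e(6/8) = −i`,
`χ(3) = e(5/8)`: `‖1 − χ(3)‖² = 2 + √2`), `17.15` (`χ(2) = i`, `χ(3) = e(3/8)`): each is the tree theorem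
`WeilPositivityOnChar χ (4023/5000)` (hence `18/25`, `3/4`). With `CensusFrontierDouble.lean`: 11 of the 46 conjugacy
classes of conductor `≤ 20` are PROVED at the `ζ` frontier (12.11 13.12 15.2 16.3 16.5 17.4 17.8 17.16 19.18 20.3 20.19).
No named facts.
-/

noncomputable section

open Complex
open scoped Real ComplexConjugate

namespace Summit.Ventures.WeilGRH

open Literature.NumberTheory.LFunctions

/-- `e^{iθ} = −i` when `cos θ = 0`, `sin θ = −1`. [folklore] -/
theorem cexp_mul_I_eq_neg_I {θ : ℝ} (hc : Real.cos θ = 0) (hs : Real.sin θ = -1) : cexp ((θ : ℂ) * I) = -I := by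
  rw [Complex.exp_mul_I, ← Complex.ofReal_cos, ← Complex.ofReal_sin, hc, hs]; push_cast; ring

/-- `e^{iθ} = i` when `cos θ = 0`, `sin θ = 1`. [folklore] -/
theorem cexp_mul_I_eq_I {θ : ℝ} (hc : Real.cos θ = 0) (hs : Real.sin θ = 1) : cexp ((θ : ℂ) * I) = I := by
  rw [Complex.exp_mul_I, ← Complex.ofReal_cos, ← Complex.ofReal_sin, hc, hs]; push_cast; ring

/-- `cos(2π·E/O) = 0`, `sin = −1` for `E/O = 3/4` written with `(E, O) = (3, 4)` or `(6, 8)`; `sin = 1` for `(1, 4)`, `(2, 8)`. [folklore] -/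
theorem trig_three_quarters :
    (Real.cos (2 * π * ((3 : ℕ) : ℝ) / ((4 : ℕ) : ℝ)) = 0 ∧ Real.sin (2 * π * ((3 : ℕ) : ℝ) / ((4 : ℕ) : ℝ)) = -1) ∧
    (Real.cos (2 * π * ((6 : ℕ) : ℝ) / ((8 : ℕ) : ℝ)) = 0 ∧ Real.sin (2 * π * ((6 : ℕ) : ℝ) / ((8 : ℕ) : ℝ)) = -1) ∧
    (Real.cos (2 * π * ((1 : ℕ) : ℝ) / ((4 : ℕ) : ℝ)) = 0 ∧ Real.sin (2 * π * ((1 : ℕ) : ℝ) / ((4 : ℕ) : ℝ)) = 1) ∧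
    (Real.cos (2 * π * ((2 : ℕ) : ℝ) / ((8 : ℕ) : ℝ)) = 0 ∧ Real.sin (2 * π * ((2 : ℕ) : ℝ) / ((8 : ℕ) : ℝ)) = 1) := by
  have e1 : (2 * π * ((3 : ℕ) : ℝ) / ((4 : ℕ) : ℝ) : ℝ) = π / 2 + π := by push_cast; ring
  have e2 : (2 * π * ((6 : ℕ) : ℝ) / ((8 : ℕ) : ℝ) : ℝ) = π / 2 + π := by push_cast; ring
  have e3 : (2 * π * ((1 : ℕ) : ℝ) / ((4 : ℕ) : ℝ) : ℝ) = π / 2 := by push_cast; ring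
  have e4 : (2 * π * ((2 : ℕ) : ℝ) / ((8 : ℕ) : ℝ) : ℝ) = π / 2 := by push_cast; ring
  rw [e1, e2, e3, e4, Real.cos_add_pi, Real.sin_add_pi, Real.cos_pi_div_two, Real.sin_pi_div_two]
  norm_num

/-- **Cell 15.2 at `4023/5000`** (`χ(2) = −i`, `χ(3) = 0`). -/
theorem weilPositivityOnChar_frontier_census_15_2 :
    WeilPositivityOnChar ((censusRow 15 2).toChar (census20_check _ (by decide))) (4023 / 5000) := by
  have h2 : (censusRow 15 2).toChar (census20_check _ (by decide)) (2 : ZMod _) = -I := by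
    rw [two_eq_natCast'', censusRow_toChar_natCast _ 2 (by decide), show (censusRow 15 2).e 2 = 3 by decide,
      show (censusRow 15 2).ord = 4 by decide]
    exact cexp_mul_I_eq_neg_I trig_three_quarters.1.1 trig_three_quarters.1.2
  have h3 : (censusRow 15 2).toChar (census20_check _ (by decide)) (3 : ZMod _) = 0 := by
    rw [three_eq_natCast'']; exact censusRow_toChar_natCast_eq_zero _ 3 (by decide)
  exact weilPositivityOnChar_frontier_class_15_2 (by decide) _ h2 h3

/-- **Cell 15.8 at `4023/5000`** (`χ(2) = i`, `χ(3) = 0`). -/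
theorem weilPositivityOnChar_frontier_census_15_8 :
    WeilPositivityOnChar ((censusRow 15 8).toChar (census20_check _ (by decide))) (4023 / 5000) := by
  have h2 : (censusRow 15 8).toChar (census20_check _ (by decide)) (2 : ZMod _) = I := by
    rw [two_eq_natCast'', censusRow_toChar_natCast _ 2 (by decide), show (censusRow 15 8).e 2 = 1 by decide,
      show (censusRow 15 8).ord = 4 by decide]
    exact cexp_mul_I_eq_I trig_three_quarters.2.2.1.1 trig_three_quarters.2.2.1.2
  have h3 : (censusRow 15 8).toChar (census20_check _ (by decide)) (3 : ZMod _) = 0 := by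
    rw [three_eq_natCast'']; exact censusRow_toChar_natCast_eq_zero _ 3 (by decide)
  exact weilPositivityOnChar_frontier_class_15_8 (by decide) _ h2 h3

/-- **Cell 17.8 at `4023/5000`** (`χ(2) = e(6/8) = −i`, `χ(3) = e(5/8)`). -/
theorem weilPositivityOnChar_frontier_census_17_8 :
    WeilPositivityOnChar ((censusRow 17 8).toChar (census20_check _ (by decide))) (4023 / 5000) := by
  have h2 : (censusRow 17 8).toChar (census20_check _ (by decide)) (2 : ZMod _) = -I := by
    rw [two_eq_natCast'', censusRow_toChar_natCast _ 2 (by decide), show (censusRow 17 8).e 2 = 6 by decide,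
      show (censusRow 17 8).ord = 8 by decide]
    exact cexp_mul_I_eq_neg_I trig_three_quarters.2.1.1 trig_three_quarters.2.1.2
  have h3 : (3.4141 : ℝ) ≤ ‖1 - (censusRow 17 8).toChar (census20_check _ (by decide)) (3 : ZMod _)‖ ^ 2 ∧
      ‖1 - (censusRow 17 8).toChar (census20_check _ (by decide)) (3 : ZMod _)‖ ^ 2 ≤ 3.4144 := by
    rw [three_eq_natCast'', normSq_one_sub_censusChar _ 3 (by decide), show (censusRow 17 8).e 3 = 5 by decide,
      show (censusRow 17 8).ord = 8 by decide]
    exact twoSubTwoCos_5_8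
  exact weilPositivityOnChar_frontier_class_17_8 (by decide) _ h2 h3.1 h3.2

/-- **Cell 17.15 at `4023/5000`** (`χ(2) = e(2/8) = i`, `χ(3) = e(3/8)`). -/
theorem weilPositivityOnChar_frontier_census_17_15 :
    WeilPositivityOnChar ((censusRow 17 15).toChar (census20_check _ (by decide))) (4023 / 5000) := by
  have h2 : (censusRow 17 15).toChar (census20_check _ (by decide)) (2 : ZMod _) = I := by
    rw [two_eq_natCast'', censusRow_toChar_natCast _ 2 (by decide), show (censusRow 17 15).e 2 = 2 by decide,
      show (censusRow 17 15).ord = 8 by decide]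
    exact cexp_mul_I_eq_I trig_three_quarters.2.2.2.1 trig_three_quarters.2.2.2.2
  have h3 : (3.4141 : ℝ) ≤ ‖1 - (censusRow 17 15).toChar (census20_check _ (by decide)) (3 : ZMod _)‖ ^ 2 ∧
      ‖1 - (censusRow 17 15).toChar (census20_check _ (by decide)) (3 : ZMod _)‖ ^ 2 ≤ 3.4144 := by
    rw [three_eq_natCast'', normSq_one_sub_censusChar _ 3 (by decide), show (censusRow 17 15).e 3 = 3 by decide,
      show (censusRow 17 15).ord = 8 by decide]
    exact twoSubTwoCos_3_8
  exact weilPositivityOnChar_frontier_class_17_15 (by decide) _ h2 h3.1 h3.2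

end Summit.Ventures.WeilGRH
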